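import Literature.Computability.AlgebraicComplexity.IK2020TableauLiftingLeftPart
import HarnessLib

/-!
# Ikenmeyer–Kandasamy 2020, §19 and §21: the left part of the lifted tableau (odd `D`)

References: C. Ikenmeyer, U. Kandasamy, "Implementing geometric complexity theory: on the
separation of orbit closures via symmetries", STOC 2020 / arXiv:1911.03990 (bib key
`IkenmeyerKandasamy2019`), §19 "Construction of `leftpart(T)` for odd `D`" (TeX L2992–3200;
chunks p0028–p0029 of the held text `paper:arxiv-1911.03990`) and §21 "Proof of the Tableau
Lifting Theorem for odd `D`" (TeX L3290–3560; chunks p0030:L100–p0033).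

Brick O1 of the multi-seat program for the named fact `IK2020_thm_13_1`
(`AC/IK20HighestWeightVectors.lean`; route note `HOME/bip/NOTE-t08g4-IK2020Thm131-route.md`): the
odd-`D` analogue of brick E2 (`IK2020TableauLiftingLeftPart.lean`), whose `LinkData`, `rowPerm`,
`phi0`, `ucol` and counting lemmas are reused. Definitions with bodies and proved lemmas only; no
named fact; net debt 0. Honest framing: bookkeeping of a published proof; VP ≠ VNP is NOT proved
and nothing here is progress on it.

## Rendering

As in E2 the vertices of `H^{(i)}` are `Fin n_i × Fin D` with block edges the fibres of the first
projection; now `H^{(i)}` is `(D, ϱ_i)`-PAIRED (Def. 18.1): the block edges come in pairs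
`{k, k̄}` (`kbar`), the two block edges of a pair being joined by a name edge through their BRIDGE
vertices (`br k ∈` block edge `k`, `ℓ(br k) = ℓ(br k̄)`). The three symbol kinds `i_ℓ`, `j_k^i`,
`j_k̄^i` of §13 are the symbols of `IK2020.LiftSym m n ϱ` with `n_i = 2 ·` (number of pairs): the
block symbol of the block edge `k` is `j_k^i`, that of its partner is `j_k̄^i`. The choice of the
`m - 1` distinct `D`-subsets `barred(i,j,k)` of the `2D` vertices of the `k`-th pair (§19 "From `B`
to `B́`", eq. (19.4) 'eq:bridgebar') is recorded as the ROW-DEPENDENT LABEL `β(i,j,v) = kbar(i,j,v)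
∈ {k(v), k̄(v)}` (print: "`kbar(i,j,v) := k̄(v)` if `v ∈ barred(i,j,k(v))`, `k(v)` otherwise"):
`barred(i,j,·)` is a fibre of `β(i,j,·)`, has `D` elements (`card_β`), the sets for different `j`
differ (`β_ne`), and one bridge vertex of each pair lies in all of them and the other in none —
normalised here as `β(i,j, br k) = k` for every row `j` (`β_br`). All of this is `IK2020.OddLinkData`
(§A); brick O2 constructs it from the chain hypergraphs of Prop. 18.3.

## Contents

* §A `OddLinkData` (extends `LinkData`).
* §B the columns `B́_v` (`colA`, eqs. (19.5)/(19.6) 'eq:acuteiBv'/'eq:acutejBv') and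
  `B̌ = leftpart(T)` (`leftpart`, via E2's `rowPerm`; eqs. (19.9)–(19.15), Claim 39).
* §C contents: Claim 41 (`lcount_name`), Claim 44 (`lcount_block`), part (3) left half
  (`base_leftpart`).
* §D **Claim 45** (printed Claim 21.1 'cla:barcoincide'): if `leftpart(φ(T))` is regular then
  `φ(j_k^i) = φ(j_k̄^i)` (`phi_block_kbar`). The printed proof counts "abound"/"scarce" symbols in
  the `2D - 1` columns `B́'`; we give a shorter argument from the same ingredients (the two bridge
  columns, the regularity of the non-link columns of the pair, `|barred| = D`, distinctness): with
  `a_j = φ(j_k^i)`, `c_j = φ(j_k̄^i)`, an equality `a_j = c_{j'}` with `j ≠ j'` forces the link vertex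
  to lie in `barred(j') ∖ barred(j)` (`β_link_of_eq`), and a two-step chase through
  `c⁻¹ ∘ a` yields a contradiction.
* §E Claims 46–48 (`phi_name_eq`, `phi_name`, `phi0_injOn`, `phi_block_h₀`) and part (2):
  properties (I)–(III) / Claims 49–53 (`phi_leftpart_eq_ucol`) and `even_card_filter_leftpart`,
  exactly as in E2 once `φ(j^i_{β(i,j,v)}) = φ(j^i_{k(v)})` (`phi_block_β`, from Claim 45).
-/

namespace Literature.Computability.AlgebraicComplexity

namespace IK2020

open Finset

/-! ## §A  The data of the paired hypergraphs `H^{(i)}` in function form -/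

/-- **What §§19–21 use of the `(D, ϱ_i)`-paired-hypergraphs `H^{(i)}`** (Def. 18.1, §19 TeX
L2992–3080, §21 proof of Claim 45) on top of `IK2020.LinkData`: the pairing `k ↦ k̄` of the block
edges (Def. 18.1: "each block edge `e` is paired with another block edge `ē` … `ē̄ = e`"); the
row-dependent labels `β(i,j,v) ∈ {k(v), k̄(v)}` (§19, `kbar(i,j,v)`), each label carried by exactly
`D` vertices (the sets `barred(i,j,k)` have cardinality `D`, eq. (19.7)), pairwise different label
patterns on every pair for different rows `j ≠ j'` ("`m - 1` many distinct … subsets"); the bridge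
vertex `br k` of the block edge `k` (Def. 18.1), labelled `k` in every row (eq. (19.4): "one of the
two bridge vertices is contained in all the `m - 1` many sets …, and the other bridge vertex is
contained in none"), the two bridge vertices of a pair lying in a common name edge (Def. 18.1), and
the link vertex not being a bridge vertex (§21: "Note that `ζ^{(i)}` is not a bridge vertex").
[cite: IkenmeyerKandasamy2019, Def. 18.1] -/
structure OddLinkData (m D : ℕ) (n ρ : Fin m → ℕ) extends LinkData m D n ρ where
  /-- the partner `k̄` of the block edge `k` -/
  kbar : (i : Fin m) → Fin (n i) → Fin (n i)
  /-- `k̄ ≠ k` -/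
  kbar_ne : ∀ i k, kbar i k ≠ k
  /-- `k̄̄ = k` -/
  kbar_kbar : ∀ i k, kbar i (kbar i k) = k
  /-- the label `kbar(i,j,v)` of the vertex `v` of `H^{(i)}` in row `j` -/
  β : (i : Fin m) → Fin m → Fin (n i) × Fin D → Fin (n i)
  /-- `kbar(i,j,v) ∈ {k(v), k̄(v)}` -/
  β_mem : ∀ i j v, β i j v = v.1 ∨ β i j v = kbar i v.1
  /-- every label is carried by `D` vertices (`|barred(i,j,k)| = D`) -/
  card_β : ∀ i j k, (univ.filter fun v => β i j v = k).card = D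
  /-- the label patterns of two rows `j ≠ j'` differ on every pair (distinctness of the sets
  `barred(i,j,k)`, `j ≠ i`) -/
  β_ne : ∀ i (j j' : Fin m), j ≠ i → j' ≠ i → j ≠ j' → ∀ k : Fin (n i),
    ∃ v : Fin (n i) × Fin D, (v.1 = k ∨ v.1 = kbar i k) ∧ β i j v ≠ β i j' v
  /-- the bridge vertex of the block edge `k` -/
  br : (i : Fin m) → Fin (n i) → Fin (n i) × Fin D
  /-- … lies in the block edge `k` -/
  fst_br : ∀ i k, (br i k).1 = k
  /-- … and is labelled `k` in every row -/
  β_br : ∀ i j k, β i j (br i k) = k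
  /-- the bridge vertices of a pair lie in a common name edge -/
  ℓ_br : ∀ i k, ℓ i (br i k) = ℓ i (br i (kbar i k))
  /-- the link vertex is not a bridge vertex -/
  ζ_ne_br : ∀ i (h : ρ i ≠ 0) k, ζ i h ≠ br i k

namespace OddLinkData

variable {m D : ℕ} {n ρ : Fin m → ℕ} (X : OddLinkData m D n ρ)

/-- A vertex labelled `k` in some row lies in the pair of `k`. [cite: IkenmeyerKandasamy2019, §19] -/
theorem fst_or_of_β_eq {i j : Fin m} {v : Fin (n i) × Fin D} {k : Fin (n i)} (h : X.β i j v = k) :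
    v.1 = k ∨ v.1 = X.kbar i k := by
  rcases X.β_mem i j v with h' | h'
  · exact Or.inl (h'.symm.trans h)
  · right
    rw [← h, h', X.kbar_kbar]

/-- A vertex of the pair `{k, k̄}` is labelled `k` or `k̄` in every row.
[cite: IkenmeyerKandasamy2019, §19] -/
theorem β_eq_or_of_fst {i : Fin m} (j : Fin m) {v : Fin (n i) × Fin D} {k : Fin (n i)}
    (h : v.1 = k ∨ v.1 = X.kbar i k) : X.β i j v = k ∨ X.β i j v = X.kbar i k := by
  rcases X.β_mem i j v with h' | h' <;> rcases h with h | h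
  · exact Or.inl (h'.trans h)
  · exact Or.inr (h'.trans h)
  · exact Or.inr (by rw [h', h])
  · exact Or.inl (by rw [h', h, X.kbar_kbar])

/-- The column of a bridge vertex is not a link column. [cite: IkenmeyerKandasamy2019, §21] -/
theorem not_isLink_br (i : Fin m) (k : Fin (n i)) : ¬ X.IsLink ⟨i, X.br i k⟩ := by
  rintro ⟨h, he⟩
  exact X.ζ_ne_br i h k he.symm

/-- For `i ∈ I` the only link column of `H^{(i)}` is that of `ζ^{(i)}`. [cite: IkenmeyerKandasamy2019, §19] -/
theorem isLink_iff {i : Fin m} (hi : ρ i ≠ 0) (v : Fin (n i) × Fin D) :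
    X.IsLink ⟨i, v⟩ ↔ v = X.ζ i hi :=
  ⟨fun ⟨_, h⟩ => h, fun h => ⟨hi, h⟩⟩

/-! ## §B  The columns `B́_v` and the left part `B̌` -/

/-- **The column `B́_v`** of the vertex `v` of `H^{(i)}` (§19, eqs. (19.5)/(19.6)
'eq:acuteiBv'/'eq:acutejBv', TeX L3076–3079): "the `i`-th entry of `B́_v` is `i_{ℓ(v)}`; the `j`-th
entry (`j ≠ i`) of `B́_v` is `j^i_{kbar(i,j,v)}`". [cite: IkenmeyerKandasamy2019, §19] -/
def colA (c : LCol m D n) (r : Fin m) : LiftSym m n ρ :=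
  if h : r = c.1 then LiftSym.name c.1 (X.ℓ c.1 c.2) else LiftSym.block c.1 (X.β c.1 r c.2) r h

/-- **`leftpart(T) = ∑_i ∑_e B̌_e`** (eq. (19.1)): `B̌` arises from `B́` exactly as in the even case
(§19 "From `B́` to `B̌`", TeX L3111–3116: "`B̌_{ζ^{(i)}}` arises from `B́_{ζ^{(i)}}` by switching the
`i`-th entry with the `i`-th entry in `B́_{ζ^{(h)}}`"), i.e. by E2's row permutations `rowPerm`.
[cite: IkenmeyerKandasamy2019, §19] -/
def oleftpart (c : LCol m D n) (r : Fin m) : LiftSym m n ρ :=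
  X.colA (X.rowPerm r c) r

/-- eq. (19.5): the `i`-th entry of `B́_v` is `i_{ℓ(v)}`. [cite: IkenmeyerKandasamy2019, §19] -/
theorem colA_self (i : Fin m) (v : Fin (n i) × Fin D) :
    X.colA ⟨i, v⟩ i = LiftSym.name i (X.ℓ i v) := by
  simp [colA]

/-- eq. (19.6): the `j`-th entry (`j ≠ i`) of `B́_v` is `j^i_{kbar(i,j,v)}`.
[cite: IkenmeyerKandasamy2019, §19] -/
theorem colA_of_ne {i : Fin m} {v : Fin (n i) × Fin D} {r : Fin m} (h : r ≠ i) :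
    X.colA ⟨i, v⟩ r = LiftSym.block i (X.β i r v) r h := by
  simp [colA, h]

/-- The `i`-th entry of `B́_{ζ^{(i)}}` is `i_{ℓ(ζ^{(i)})}`. [cite: IkenmeyerKandasamy2019, §19] -/
theorem colA_linkCol_self (i : Fin m) (hi : ρ i ≠ 0) :
    X.colA (X.linkCol i hi) i = LiftSym.name i (X.ℓ i (X.ζ i hi)) :=
  X.colA_self i _

/-- The `j`-th entry (`j ≠ i`) of `B́_{ζ^{(i)}}` is `j^i_{kbar(i,j,ζ^{(i)})}`.
[cite: IkenmeyerKandasamy2019, §19] -/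
theorem colA_linkCol_of_ne {i r : Fin m} (hi : ρ i ≠ 0) (h : r ≠ i) :
    X.colA (X.linkCol i hi) r = LiftSym.block i (X.β i r (X.ζ i hi)) r h :=
  X.colA_of_ne h

/-- Every entry of `B́_v` belongs to the hypergraph of `v`. [cite: IkenmeyerKandasamy2019, §19] -/
theorem owner_colA (c : LCol m D n) (r : Fin m) : (X.colA c r).owner = c.1 := by
  unfold colA
  split_ifs <;> rfl

/-- Under `φ(i_ℓ) = i`, `φ(j_k^i) = φ(j_k̄^i) = j` the row-`r` entry of every `B́_v` becomes `r`.
[cite: IkenmeyerKandasamy2019, §21] -/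
theorem base_colA (c : LCol m D n) (r : Fin m) : (X.colA c r).base = r := by
  unfold colA
  split_ifs with h
  · rw [LiftSym.base_name, h]
  · rfl

/-- **Claim 39 (1) / eqs. (19.9), (19.10)**: the column of a non-link vertex in `leftpart(T)` is
`B́_v`. [cite: IkenmeyerKandasamy2019, §19] -/
theorem leftpart_of_not_isLink {c : LCol m D n} (hc : ¬ X.IsLink c) (r : Fin m) :
    X.oleftpart c r = X.colA c r := by
  rw [oleftpart, X.rowPerm_of_not_isLink hc]

/-- **eqs. (19.11)/(19.13)**: the `i`-th entry of `B̌_{ζ^{(i)}}` is the `i`-th entry of `B́_{ζ^{(h)}}`.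
[cite: IkenmeyerKandasamy2019, §19] -/
theorem leftpart_linkCol_self (i : Fin m) (hi : ρ i ≠ 0) :
    X.oleftpart (X.linkCol i hi) i = X.colA (X.linkCol X.h₀ X.ρ_h₀) i := by
  rw [oleftpart, X.rowPerm_linkCol_self]

/-- eq. (19.11): for `i ∈ I`, `i ≠ h`, the `i`-th entry of `B̌_{ζ^{(i)}}` is `i^h_{kbar(h,i,ζ^{(h)})}`
(Claim 39 (2): "`i_1^h` or `i_{1̄}^h` instead of `i_1`"). [cite: IkenmeyerKandasamy2019, §19] -/
theorem leftpart_linkCol_self_of_ne (i : Fin m) (hi : ρ i ≠ 0) (hih : i ≠ X.h₀) :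
    X.oleftpart (X.linkCol i hi) i =
      LiftSym.block X.h₀ (X.β X.h₀ i (X.ζ X.h₀ X.ρ_h₀)) i hih := by
  rw [X.leftpart_linkCol_self, X.colA_linkCol_of_ne X.ρ_h₀ hih]

/-- eqs. (19.13)/(19.14): for `j ∈ I` the `j`-th entry of `B̌_{ζ^{(h)}}` is `j_{ℓ(ζ^{(j)})}` (= `j_1`).
[cite: IkenmeyerKandasamy2019, §19] -/
theorem leftpart_linkCol_h₀ (r : Fin m) (hr : ρ r ≠ 0) :
    X.oleftpart (X.linkCol X.h₀ X.ρ_h₀) r = LiftSym.name r (X.ℓ r (X.ζ r hr)) := by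
  rw [oleftpart, X.rowPerm_linkCol_h₀ r hr, X.colA_linkCol_self]

/-- eq. (19.15): "for `j ≠ h`, `j ∉ I`, the `j`-th entry of `B̌_{ζ^{(h)}}` is `j^h_{kbar(h,j,ζ^{(h)})}`".
[cite: IkenmeyerKandasamy2019, §19] -/
theorem leftpart_linkCol_h₀_of_eq_zero (r : Fin m) (hr : ρ r = 0) (hrh : r ≠ X.h₀) :
    X.oleftpart (X.linkCol X.h₀ X.ρ_h₀) r =
      LiftSym.block X.h₀ (X.β X.h₀ r (X.ζ X.h₀ X.ρ_h₀)) r hrh := by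
  rw [oleftpart, X.rowPerm_of_eq_zero hr, Equiv.Perm.one_apply, X.colA_linkCol_of_ne X.ρ_h₀ hrh]

/-- eq. (19.12): for `i ∈ I`, `i ≠ h`, the `j`-th entry (`j ≠ i`) of `B̌_{ζ^{(i)}}` is
`j^i_{kbar(i,j,ζ^{(i)})}`. [cite: IkenmeyerKandasamy2019, §19] -/
theorem leftpart_linkCol_of_ne {i r : Fin m} (hi : ρ i ≠ 0) (hih : i ≠ X.h₀) (hri : r ≠ i) :
    X.oleftpart (X.linkCol i hi) r = LiftSym.block i (X.β i r (X.ζ i hi)) r hri := by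
  rw [oleftpart, X.rowPerm_linkCol_of_ne hi hih hri, X.colA_linkCol_of_ne hi hri]

/-! ## §C  Contents of `leftpart(T)` (Claims 41, 44) and part (3) -/

/-- **Claim 40 / part (3), left half**: under `φ(i_ℓ) = i`, `φ(j_k^i) = φ(j_k̄^i) = j` every column
of `leftpart(φ(T))` "contains all entries `1,…,m`, sorted from top to bottom" (§21, chunk
p0031.txt:L17–18). [cite: IkenmeyerKandasamy2019, §21] -/
theorem base_leftpart (c : LCol m D n) (r : Fin m) : (X.oleftpart c r).base = r :=
  X.base_colA _ r

/-- Hence `leftpart(φ(T))` is regular for this `φ`. [cite: IkenmeyerKandasamy2019, §21] -/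
theorem injective_base_leftpart (c : LCol m D n) :
    Function.Injective fun r => (X.oleftpart c r).base := by
  intro r r' h
  simpa only [X.base_leftpart] using h

/-- Every row of `B̌` is a permutation of the same row of `B́` (proofs of Claims 41/44:
"`leftpart(T)` is obtained by a permutation of the box entries"). [cite: IkenmeyerKandasamy2019, §19] -/
theorem lcount_oleftpart_eq_colA (u : LiftSym m n ρ) :
    ∑ c, (univ.filter fun r => X.oleftpart c r = u).card =
      ∑ c, (univ.filter fun r => X.colA c r = u).card := by
  simp only [Finset.card_filter]
  rw [Finset.sum_comm]
  conv_rhs => rw [Finset.sum_comm]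
  refine Finset.sum_congr rfl fun r _ => ?_
  exact Equiv.sum_comp (X.rowPerm r) (fun c => if X.colA c r = u then 1 else 0)

/-- Only the columns of `H^{(i)}` carry symbols of `H^{(i)}`. [cite: IkenmeyerKandasamy2019, §19] -/
theorem lcount_colA_eq_sum_owner (u : LiftSym m n ρ) :
    ∑ c, (univ.filter fun r => X.colA c r = u).card =
      ∑ v : Fin (n u.owner) × Fin D, (univ.filter fun r => X.colA ⟨u.owner, v⟩ r = u).card := by
  rw [Fintype.sum_sigma, Finset.sum_eq_single u.owner]
  · intro i _ hne
    refine Finset.sum_eq_zero fun v _ => ?_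
    rw [Finset.card_eq_zero, Finset.filter_eq_empty_iff]
    intro r _ h
    exact hne (by rw [← h, X.owner_colA])
  · simp

/-- **Claim 41 (printed 'cla:symbolsleft', odd case)**: `i_ℓ` appears in `leftpart(T)` "exactly as
many times as there are vertices `v` in `H^{(i)}` with `ℓ(v) = ℓ`". [cite: IkenmeyerKandasamy2019, §19] -/
theorem lcount_name (i : Fin m) (a : Fin (n i + ρ i)) :
    ∑ c, (univ.filter fun r => X.oleftpart c r = LiftSym.name i a).card =
      (univ.filter fun v => X.ℓ i v = a).card := by
  rw [X.lcount_oleftpart_eq_colA, X.lcount_colA_eq_sum_owner, LiftSym.owner_name, Finset.card_filter]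
  refine Finset.sum_congr rfl fun v _ => ?_
  have hset : (univ.filter fun r => X.colA ⟨i, v⟩ r = LiftSym.name i a) =
      if X.ℓ i v = a then {i} else ∅ := by
    ext r
    simp only [Finset.mem_filter, Finset.mem_univ, true_and]
    by_cases hr : r = i
    · subst hr
      rw [X.colA_self, LiftSym.name_eq_name_iff]
      split_ifs with h <;> simp [h]
    · rw [X.colA_of_ne hr]
      have hne : (LiftSym.block i (X.β i r v) r hr : LiftSym m n ρ) ≠ LiftSym.name i a :=
        Sum.inr_ne_inl
      simp only [hne, false_iff]
      split_ifs <;> simp [hr]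
  rw [hset]
  split_ifs <;> simp

/-- **Claim 44 (printed 'cla:jki', odd case)**: "if a symbol `j_k^i` or `j_k̄^i` appears in `T`, then
it appears exactly `D` many times" — in row `j` of the `D` columns `v` with `kbar(i,j,v) = k`
(eq. (19.7) 'eq:Dmanysymbols' and `|barred| = D`). [cite: IkenmeyerKandasamy2019, §20] -/
theorem lcount_block (i : Fin m) (k : Fin (n i)) (j : Fin m) (hj : j ≠ i) :
    ∑ c, (univ.filter fun r => X.oleftpart c r = LiftSym.block i k j hj).card = D := by
  rw [X.lcount_oleftpart_eq_colA, X.lcount_colA_eq_sum_owner, LiftSym.owner_block]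
  refine Eq.trans ?_ (X.card_β i j k)
  rw [Finset.card_filter]
  refine Finset.sum_congr rfl fun v _ => ?_
  have hset : (univ.filter fun r => X.colA ⟨i, v⟩ r = LiftSym.block i k j hj) =
      if X.β i j v = k then {j} else ∅ := by
    ext r
    simp only [Finset.mem_filter, Finset.mem_univ, true_and]
    by_cases hr : r = i
    · subst hr
      rw [X.colA_self]
      have hne : (LiftSym.name r (X.ℓ r v) : LiftSym m n ρ) ≠ LiftSym.block r k j hj :=
        Sum.inl_ne_inr
      simp only [hne, false_iff]
      split_ifs <;> simp [hj.symm]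
    · rw [X.colA_of_ne hr, LiftSym.block_eq_block_iff]
      by_cases hrj : r = j
      · subst hrj
        split_ifs with h <;> simp [h]
      · have h1 : ¬ (X.β i r v = k ∧ r = j) := fun h => hrj h.2
        simp only [h1, false_iff]
        split_ifs <;> simp [hrj]
  rw [hset]
  split_ifs <;> simp

/-! ## §D  Claim 45: `φ(j_k^i) = φ(j_k̄^i)` -/

section regular

variable {φ : LiftSym m n ρ → Fin m}

/-- The column of the bridge vertex `br k` under `φ`: row `j ≠ i` carries `φ(j_k^i)` (all rows label
the bridge vertex by `k`, eq. (19.4)). [cite: IkenmeyerKandasamy2019, §19] -/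
theorem phi_leftpart_br_of_ne (i : Fin m) (k : Fin (n i)) {r : Fin m} (hr : r ≠ i) :
    φ (X.oleftpart ⟨i, X.br i k⟩ r) = φ (LiftSym.block i k r hr) := by
  rw [X.leftpart_of_not_isLink (X.not_isLink_br i k), X.colA_of_ne hr, X.β_br]

/-- … and row `i` carries `φ(i_ℓ)`, `ℓ = ℓ(br k) = ℓ(br k̄)` the common name edge of the two bridge
vertices (eq. (19.8) 'eq:bridge': "`B́_v + B́_w` contains all symbols from `S`").
[cite: IkenmeyerKandasamy2019, §19] -/
theorem phi_leftpart_br_self (i : Fin m) (k : Fin (n i)) :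
    φ (X.oleftpart ⟨i, X.br i k⟩ i) = φ (LiftSym.name i (X.ℓ i (X.br i k))) := by
  rw [X.leftpart_of_not_isLink (X.not_isLink_br i k), X.colA_self]

/-- **The key step of Claim 45** (our rendering of "abound/scarce", chunk p0031.txt:L60–110): let
`leftpart(φ(T))` be regular, `i ∈ I`, `{k, k̄}` a pair, `j, j' ≠ i` two different rows with
`φ(j_k^i) = φ(j'_{k̄}^i)`. A non-link column `v` of the pair cannot carry `j_k^i` in row `j` AND
`j'_{k̄}^i` in row `j'`; so `barred(j)ᶜ ∖ {ζ} ⊆ barred(j')ᶜ`, and since both have `D` elements but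
differ (distinctness), the link vertex `ζ^{(i)}` is labelled `k` in row `j` and `k̄` in row `j'`.
[cite: IkenmeyerKandasamy2019, Claim 21.1] -/
theorem β_link_of_eq (hreg : ∀ c, Function.Injective fun r => φ (X.oleftpart c r))
    {i : Fin m} (hi : ρ i ≠ 0) (k : Fin (n i)) {j j' : Fin m} (hj : j ≠ i) (hj' : j' ≠ i)
    (hjj' : j ≠ j') (h : φ (LiftSym.block i k j hj) = φ (LiftSym.block i (X.kbar i k) j' hj')) :
    X.β i j (X.ζ i hi) = k ∧ X.β i j' (X.ζ i hi) ≠ k := by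
  classical
  -- (1) a non-link column labelled `k` in row `j` is labelled `k` in row `j'`
  have h1 : ∀ v, v ≠ X.ζ i hi → X.β i j v = k → X.β i j' v = k := by
    intro v hv hvj
    rcases X.β_eq_or_of_fst j' (X.fst_or_of_β_eq hvj) with h' | h'
    · exact h'
    · exfalso
      have hnl : ¬ X.IsLink ⟨i, v⟩ := fun hl => hv ((X.isLink_iff hi v).mp hl)
      have key : φ (X.oleftpart ⟨i, v⟩ j) = φ (X.oleftpart ⟨i, v⟩ j') := by
        rw [X.leftpart_of_not_isLink hnl, X.leftpart_of_not_isLink hnl, X.colA_of_ne hj,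
          X.colA_of_ne hj', hvj, h', h]
      exact hjj' (hreg ⟨i, v⟩ key)
  -- (2) the two fibres have `D` elements each and differ
  by_contra hnot
  have hsub : (univ.filter fun v => X.β i j v = k) ⊆ univ.filter fun v => X.β i j' v = k := by
    intro v hv
    simp only [Finset.mem_filter, Finset.mem_univ, true_and] at hv ⊢
    by_cases hvζ : v = X.ζ i hi
    · subst hvζ
      by_contra h''
      exact hnot ⟨hv, h''⟩
    · exact h1 v hvζ hv
  have heq := Finset.eq_of_subset_of_card_le hsub (by rw [X.card_β, X.card_β])
  obtain ⟨v, hvU, hne⟩ := X.β_ne i j j' hj hj' hjj' k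
  apply hne
  have hiff : X.β i j v = k ↔ X.β i j' v = k := by
    have := congrArg (v ∈ ·) heq
    simpa using this
  rcases X.β_eq_or_of_fst j hvU with h₁ | h₁ <;> rcases X.β_eq_or_of_fst j' hvU with h₂ | h₂
  · rw [h₁, h₂]
  · exact absurd (h₂.symm.trans (hiff.mp h₁)) (X.kbar_ne i k)
  · exact absurd (h₁.symm.trans (hiff.mpr h₂)) (X.kbar_ne i k)
  · rw [h₁, h₂]

/-- **IK Claim 45 (printed Claim 21.1 'cla:barcoincide')**: "If `φ(T)` is regular, then for each
`i ∈ I`, `j ≠ i`, `k` we have `φ(j_k^i) = φ(j_k̄^i)`." Proof: read `a_j := φ(j_k^i)` and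
`c_j := φ(j_k̄^i)` off the two bridge columns (both regular: `a`, `c` are injective in `j`, avoid
`x := φ(i_ℓ)`, and `c` attains every value `≠ x`); if `a_{j₁} ≠ c_{j₁}` then `a_{j₁} = c_{j₂}` with
`j₂ ≠ j₁`, whence by `β_link_of_eq` the link vertex is labelled `k̄` in row `j₂`; but `a_{j₂} = c_{j₃}`
forces either `j₃ = j₂` (then `a_{j₁} = a_{j₂}`, `j₁ = j₂`) or, by `β_link_of_eq` again, the label
`k` in row `j₂` — a contradiction either way. Only the regularity of `leftpart(φ(T))` is used.
[cite: IkenmeyerKandasamy2019, Claim 21.1] -/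
theorem phi_block_kbar (hreg : ∀ c, Function.Injective fun r => φ (X.oleftpart c r))
    (i : Fin m) (k : Fin (n i)) (j : Fin m) (hj : j ≠ i) :
    φ (LiftSym.block i k j hj) = φ (LiftSym.block i (X.kbar i k) j hj) := by
  classical
  have hi : ρ i ≠ 0 := X.ρ_ne_zero_of_vertex i (X.br i k)
  set k' := X.kbar i k with hk'
  -- `x := φ(i_ℓ)`, the common row-`i` value of the two bridge columns
  set x := φ (LiftSym.name i (X.ℓ i (X.br i k))) with hx
  have hxk : φ (X.oleftpart ⟨i, X.br i k⟩ i) = x := X.phi_leftpart_br_self i k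
  have hxk' : φ (X.oleftpart ⟨i, X.br i k'⟩ i) = x := by
    rw [X.phi_leftpart_br_self (φ := φ), hx, X.ℓ_br i k]
  -- `a_j ≠ x`, `a` injective; `c` attains every value `≠ x`
  have ha_ne : ∀ (r : Fin m) (hr : r ≠ i), φ (LiftSym.block i k r hr) ≠ x := by
    intro r hr h
    rw [← X.phi_leftpart_br_of_ne (φ := φ) i k hr, ← hxk] at h
    exact hr (hreg _ h)
  have ha_inj : ∀ (r r' : Fin m) (hr : r ≠ i) (hr' : r' ≠ i),
      φ (LiftSym.block i k r hr) = φ (LiftSym.block i k r' hr') → r = r' := by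
    intro r r' hr hr' h
    rw [← X.phi_leftpart_br_of_ne (φ := φ) i k hr, ← X.phi_leftpart_br_of_ne (φ := φ) i k hr'] at h
    exact hreg _ h
  have hc_surj : ∀ y, y ≠ x → ∃ (r : Fin m) (hr : r ≠ i), φ (LiftSym.block i k' r hr) = y := by
    intro y hy
    obtain ⟨r, hr⟩ := Finite.surjective_of_injective (hreg ⟨i, X.br i k'⟩) y
    have hri : r ≠ i := by
      rintro rfl
      exact hy (hr.symm.trans hxk')
    exact ⟨r, hri, by rw [← X.phi_leftpart_br_of_ne (φ := φ) i k' hri]; exact hr⟩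
  -- the chase
  by_contra hne
  obtain ⟨j₂, hj₂, h₂⟩ := hc_surj _ (ha_ne j hj)
  have hjj₂ : j ≠ j₂ := by
    rintro rfl
    exact hne h₂.symm
  obtain ⟨-, hβ₂⟩ := X.β_link_of_eq hreg hi k hj hj₂ hjj₂ h₂.symm
  obtain ⟨j₃, hj₃, h₃⟩ := hc_surj _ (ha_ne j₂ hj₂)
  by_cases h23 : j₂ = j₃
  · subst h23
    exact hjj₂ (ha_inj j j₂ hj hj₂ (h₂.symm.trans h₃))
  · exact hβ₂ (X.β_link_of_eq hreg hi k hj₂ hj₃ h23 h₃.symm).1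

/-- Claim 45, label form: `φ(j^i_{kbar(i,j,v)}) = φ(j^i_{k(v)})` for every vertex `v` and row `j ≠ i`
("which we will use implicitly in the upcoming argument", proof of Claim 46).
[cite: IkenmeyerKandasamy2019, Claim 21.1] -/
theorem phi_block_β (hreg : ∀ c, Function.Injective fun r => φ (X.oleftpart c r))
    (i : Fin m) {j : Fin m} (hj : j ≠ i) (v : Fin (n i) × Fin D) :
    φ (LiftSym.block i (X.β i j v) j hj) = φ (LiftSym.block i v.1 j hj) := by
  rcases X.β_mem i j v with h | h
  · rw [h]
  · rw [h, ← X.phi_block_kbar hreg i v.1 j hj]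

/-- Row `j ≠ i` of a non-link column `B́_v` under `φ` is `φ(j^i_{k(v)})` (Claim 50: "consists of the
single element `φ(j^i_{k(e)})`"). [cite: IkenmeyerKandasamy2019, Claim 21.6] -/
theorem phi_colA_of_ne (hreg : ∀ c, Function.Injective fun r => φ (X.oleftpart c r))
    {i : Fin m} (v : Fin (n i) × Fin D) {r : Fin m} (hr : r ≠ i) :
    φ (X.colA ⟨i, v⟩ r) = φ (LiftSym.block i v.1 r hr) := by
  rw [X.colA_of_ne hr, X.phi_block_β hreg i hr]

/-! ## §E  Claims 46–48 and part (2) (Claims 49–53) -/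

/-- eq. (21.2) for non-link vertices of a common block edge (proof of Claim 46: "from each of the
`m-1` sets `{j_k^i, j_k̄^i}` there is one symbol in the column `B̌_v` … Claim 45 implies
`φ(j_k^i) = φ(j_k̄^i)` … Thus `φ(i_{ℓ(v)})` equals the one element in `{1,…,m} ∖ {φ(j_k^i)}`").
[cite: IkenmeyerKandasamy2019, Claim 21.2] -/
theorem phi_name_eq_of_fst_eq_of_not_isLink
    (hreg : ∀ c, Function.Injective fun r => φ (X.oleftpart c r)) (i : Fin m)
    {v w : Fin (n i) × Fin D} (hv : ¬ X.IsLink ⟨i, v⟩) (hw : ¬ X.IsLink ⟨i, w⟩) (h : v.1 = w.1) :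
    φ (LiftSym.name i (X.ℓ i v)) = φ (LiftSym.name i (X.ℓ i w)) := by
  have key := LinkData.apply_eq_of_injective_of_forall_ne (hreg ⟨i, v⟩) (hreg ⟨i, w⟩) i fun r hr => by
    show φ (X.oleftpart ⟨i, v⟩ r) = φ (X.oleftpart ⟨i, w⟩ r)
    rw [X.leftpart_of_not_isLink hv, X.leftpart_of_not_isLink hw, X.phi_colA_of_ne hreg v hr,
      X.phi_colA_of_ne hreg w hr, h]
  change φ (X.oleftpart ⟨i, v⟩ i) = φ (X.oleftpart ⟨i, w⟩ i) at key
  rwa [X.leftpart_of_not_isLink hv, X.leftpart_of_not_isLink hw, X.colA_self, X.colA_self] at key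

/-- eq. (21.2) for all vertices of a common block edge. [cite: IkenmeyerKandasamy2019, Claim 21.2] -/
theorem phi_name_eq_of_fst_eq (hreg : ∀ c, Function.Injective fun r => φ (X.oleftpart c r))
    (i : Fin m) {v w : Fin (n i) × Fin D} (h : v.1 = w.1) :
    φ (LiftSym.name i (X.ℓ i v)) = φ (LiftSym.name i (X.ℓ i w)) := by
  rw [← X.ℓ_unlink i v, ← X.ℓ_unlink i w]
  exact X.phi_name_eq_of_fst_eq_of_not_isLink hreg i (X.not_isLink_unlink i v)
    (X.not_isLink_unlink i w) (by rw [X.fst_unlink, X.fst_unlink, h])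

/-- **IK Claim 46 (printed Claim 21.2 'cla:varphii', odd case)**: if `φ(T)` is regular then
`φ(i_{ℓ(v)}) = φ(i_{ℓ(w)})` for all vertices of `H^{(i)}` (connectivity).
[cite: IkenmeyerKandasamy2019, Claim 21.2] -/
theorem phi_name_eq (hreg : ∀ c, Function.Injective fun r => φ (X.oleftpart c r)) (i : Fin m)
    (v w : Fin (n i) × Fin D) :
    φ (LiftSym.name i (X.ℓ i v)) = φ (LiftSym.name i (X.ℓ i w)) := by
  induction X.conn i v w with
  | refl => rfl
  | tail _ hbc ih =>
    refine ih.trans ?_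
    rcases hbc with h | h
    · exact X.phi_name_eq_of_fst_eq hreg i h
    · rw [h]

/-- Claim 46, symbol form: `φ(i_ℓ) = φ°(i)` for every name symbol (`φ°` as in E2, eq. (21.3)).
[cite: IkenmeyerKandasamy2019, Claim 21.2] -/
theorem phi_name (hreg : ∀ c, Function.Injective fun r => φ (X.oleftpart c r)) (i : Fin m)
    (a : Fin (n i + ρ i)) : φ (LiftSym.name i a) = X.phi0 φ i := by
  have hi : ρ i ≠ 0 := X.ρ_ne_zero_of_fin i a
  obtain ⟨v, hv⟩ : ∃ v, X.ℓ i v = a := by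
    obtain ⟨v, hv⟩ := Finset.card_pos.mp (X.one_le_card i a)
    exact ⟨v, (Finset.mem_filter.mp hv).2⟩
  rw [X.phi0_of_ne_zero φ hi, ← hv]
  exact X.phi_name_eq hreg i v _

/-- The column of `ζ^{(h)}` in `leftpart(φ(T))` lists `φ°(j)` in row `j ∈ I`.
[cite: IkenmeyerKandasamy2019, §21] -/
theorem phi_leftpart_linkCol_h₀ (r : Fin m) (hr : ρ r ≠ 0) :
    φ (X.oleftpart (X.linkCol X.h₀ X.ρ_h₀) r) = X.phi0 φ r := by
  rw [X.leftpart_linkCol_h₀ r hr, X.phi0_of_ne_zero φ hr]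

/-- **IK Claim 47 (printed Claim 21.3 'cla:differentphiNEW', odd case)**: `φ°` is injective on `I`.
[cite: IkenmeyerKandasamy2019, Claim 21.3] -/
theorem phi0_injOn (hreg : ∀ c, Function.Injective fun r => φ (X.oleftpart c r)) :
    Set.InjOn (X.phi0 φ) {i | ρ i ≠ 0} := by
  intro i hi j hj h
  rw [Set.mem_setOf_eq] at hi hj
  rw [← X.phi_leftpart_linkCol_h₀ i hi, ← X.phi_leftpart_linkCol_h₀ j hj] at h
  exact hreg _ h

/-- **IK Claim 48 (printed Claim 21.4 'cla:droph', odd case)**: "Let `i ∈ I`, `i ≠ h`. Then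
`φ(i_{1̄}^h) = φ(i_1^h) = φ(i_1) = φ°(i)`" (here `i^h_{k(ζ^{(h)})}`).
[cite: IkenmeyerKandasamy2019, Claim 21.4] -/
theorem phi_block_h₀ (hreg : ∀ c, Function.Injective fun r => φ (X.oleftpart c r)) {i : Fin m}
    (hi : ρ i ≠ 0) (hih : i ≠ X.h₀) :
    φ (LiftSym.block X.h₀ (X.ζ X.h₀ X.ρ_h₀).1 i hih) = X.phi0 φ i := by
  have key := LinkData.apply_eq_of_injective_of_forall_ne (hreg (X.linkCol i hi)) (hreg ⟨i, X.ξ i hi⟩) i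
    fun r hr => by
      show φ (X.oleftpart (X.linkCol i hi) r) = φ (X.oleftpart ⟨i, X.ξ i hi⟩ r)
      rw [X.leftpart_linkCol_of_ne hi hih hr, X.phi_block_β hreg i hr,
        X.leftpart_of_not_isLink (X.not_isLink_ξ i hi), X.phi_colA_of_ne hreg _ hr, X.fst_ζ i hi]
  change φ (X.oleftpart (X.linkCol i hi) i) = φ (X.oleftpart ⟨i, X.ξ i hi⟩ i) at key
  rw [X.leftpart_linkCol_self_of_ne i hi hih, X.phi_block_β hreg X.h₀ hih,
    X.leftpart_of_not_isLink (X.not_isLink_ξ i hi), X.colA_self, X.phi_name hreg] at key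
  exact key

/-- The same for the labelled symbol `i^h_{kbar(h,i,ζ^{(h)})}` actually sitting in row `i` of
`B̌_{ζ^{(i)}}`. [cite: IkenmeyerKandasamy2019, Claim 21.4] -/
theorem phi_block_h₀_β (hreg : ∀ c, Function.Injective fun r => φ (X.oleftpart c r)) {i : Fin m}
    (hi : ρ i ≠ 0) (hih : i ≠ X.h₀) :
    φ (LiftSym.block X.h₀ (X.β X.h₀ i (X.ζ X.h₀ X.ρ_h₀)) i hih) = X.phi0 φ i := by
  rw [X.phi_block_β hreg X.h₀ hih, X.phi_block_h₀ hreg hi hih]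

/-- **Properties (I)–(III) of §21** (Claims 49–53, chunks p0032.txt:L60–p0033): if `leftpart(φ(T))`
is regular then every column of the block `φ(B̌_e)` equals E2's `ucol` (`φ°(i)` in row `i`,
`φ(j^i_{k(e)})` in row `j ≠ i`). [cite: IkenmeyerKandasamy2019, §21] -/
theorem phi_leftpart_eq_ucol (hreg : ∀ c, Function.Injective fun r => φ (X.oleftpart c r))
    (c : LCol m D n) (r : Fin m) : φ (X.oleftpart c r) = X.ucol φ c.1 c.2.1 r := by
  obtain ⟨i, v⟩ := c
  dsimp only
  by_cases hc : X.IsLink ⟨i, v⟩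
  · obtain ⟨hi, hv⟩ := hc
    dsimp only at hi hv
    subst hv
    change φ (X.oleftpart (X.linkCol i hi) r) = X.ucol φ i (X.ζ i hi).1 r
    by_cases hr : r = i
    · rw [hr, X.ucol_self]
      by_cases hih : i = X.h₀
      · subst hih
        exact X.phi_leftpart_linkCol_h₀ (φ := φ) X.h₀ hi
      · rw [X.leftpart_linkCol_self_of_ne i hi hih, X.phi_block_h₀_β hreg hi hih]
    · rw [X.ucol_of_ne φ _ hr]
      by_cases hih : i = X.h₀
      · subst hih
        change φ (X.oleftpart (X.linkCol X.h₀ X.ρ_h₀) r) =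
          φ (LiftSym.block X.h₀ (X.ζ X.h₀ X.ρ_h₀).1 r hr)
        by_cases hρr : ρ r = 0
        · rw [X.leftpart_linkCol_h₀_of_eq_zero r hρr hr, X.phi_block_β hreg X.h₀ hr]
        · rw [X.phi_leftpart_linkCol_h₀ (φ := φ) r hρr, ← X.phi_block_h₀ hreg hρr hr]
      · rw [X.leftpart_linkCol_of_ne hi hih hr, X.phi_block_β hreg i hr]
  · rw [X.leftpart_of_not_isLink hc]
    by_cases hr : r = i
    · rw [hr, X.ucol_self, X.colA_self, X.phi_name hreg]
    · rw [X.ucol_of_ne φ _ hr, X.phi_colA_of_ne hreg v hr]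

/-- The columns of `leftpart(φ(T))` as functions. [cite: IkenmeyerKandasamy2019, §21] -/
theorem phi_leftpart_funext (hreg : ∀ c, Function.Injective fun r => φ (X.oleftpart c r))
    (c : LCol m D n) : (fun r => φ (X.oleftpart c r)) = X.ucol φ c.1 c.2.1 :=
  funext fun r => X.phi_leftpart_eq_ucol hreg c r

/-- **Part (2) of Thm. 13.1 for odd `D`, column form** (§21: "a uniform tableau with an even number
of columns is duplex … (I)–(III)"): although `D` is odd, every block edge comes with its partner
and `φ(B̌_e) = φ(B̌_ē)` columnwise (`ucol` depends on `φ(j_k^i) = φ(j_k̄^i)` only), so every column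
of `leftpart(φ(T))` occurs an even number of times: whole PAIRS of block edges, `2D` columns each.
[cite: IkenmeyerKandasamy2019, Thm. 13.1] -/
theorem even_card_filter_leftpart
    (hreg : ∀ c, Function.Injective fun r => φ (X.oleftpart c r)) (c : LCol m D n) :
    Even ((univ.filter fun c' : LCol m D n =>
      (fun r => φ (X.oleftpart c' r)) = fun r => φ (X.oleftpart c r)).card) := by
  classical
  have h1 : (univ.filter fun c' : LCol m D n =>
      (fun r => φ (X.oleftpart c' r)) = fun r => φ (X.oleftpart c r)) =
      univ.filter fun c' : LCol m D n => X.ucol φ c'.1 c'.2.1 = X.ucol φ c.1 c.2.1 :=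
    Finset.filter_congr fun c' _ => by
      rw [X.phi_leftpart_funext hreg c', X.phi_leftpart_funext hreg c]
  -- `ucol` is constant on pairs of block edges
  have hpair : ∀ (i : Fin m) (k : Fin (n i)), X.ucol φ i (X.kbar i k) = X.ucol φ i k := by
    intro i k
    funext r
    by_cases hr : r = i
    · rw [hr, X.ucol_self, X.ucol_self]
    · rw [X.ucol_of_ne φ _ hr, X.ucol_of_ne φ _ hr, ← X.phi_block_kbar hreg i k r hr]
  -- group the columns by pair of block edges: the representative `min(k, k̄)` as a block index
  let rep : (Σ j : Fin m, Fin (n j)) → (Σ j : Fin m, Fin (n j)) :=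
    fun κ => if κ.2 ≤ X.kbar κ.1 κ.2 then κ else ⟨κ.1, X.kbar κ.1 κ.2⟩
  rw [h1, Finset.card_eq_sum_card_fiberwise
    (f := fun c' : LCol m D n => rep ⟨c'.1, c'.2.1⟩) (t := univ) fun _ _ => Finset.mem_univ _]
  refine Finset.even_sum _ fun κ _ => ?_
  -- the fibre of `rep` over `κ` inside the filter is empty or a whole pair (`2D` columns)
  have hfib : ∀ (i : Fin m) (k : Fin (n i)), rep ⟨i, k⟩ = ⟨i, k⟩ ∨ rep ⟨i, k⟩ = ⟨i, X.kbar i k⟩ := by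
    intro i k
    simp only [rep]
    split_ifs
    · exact Or.inl rfl
    · exact Or.inr rfl
  have hrep_kbar : ∀ (i : Fin m) (k : Fin (n i)), rep ⟨i, X.kbar i k⟩ = rep ⟨i, k⟩ := by
    intro i k
    simp only [rep, X.kbar_kbar]
    by_cases h : k ≤ X.kbar i k
    · rw [if_pos h]
      by_cases h' : X.kbar i k ≤ k
      · exact absurd (le_antisymm h' h) (X.kbar_ne i k)
      · rw [if_neg h']
    · rw [if_neg h]
      have h' : X.kbar i k ≤ k := le_of_lt (not_le.mp h)
      rw [if_pos h']
  obtain ⟨i, k⟩ := κ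
  by_cases hκ : X.ucol φ i k = X.ucol φ c.1 c.2.1 ∧ rep ⟨i, k⟩ = ⟨i, k⟩
  · -- the whole pair `{k, k̄}`
    obtain ⟨hκ, hrepk⟩ := hκ
    have hset : ((univ.filter fun c' : LCol m D n =>
        X.ucol φ c'.1 c'.2.1 = X.ucol φ c.1 c.2.1).filter
        fun c' => rep ⟨c'.1, c'.2.1⟩ = ⟨i, k⟩) =
        (univ.filter fun c' : LCol m D n =>
          (⟨c'.1, c'.2.1⟩ : Σ j : Fin m, Fin (n j)) = ⟨i, k⟩) ∪
        (univ.filter fun c' : LCol m D n =>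
          (⟨c'.1, c'.2.1⟩ : Σ j : Fin m, Fin (n j)) = ⟨i, X.kbar i k⟩) := by
      ext c'
      simp only [Finset.mem_filter, Finset.mem_univ, true_and, Finset.mem_union]
      obtain ⟨i', k', t'⟩ := c'
      dsimp only
      constructor
      · rintro ⟨-, h⟩
        rcases hfib i' k' with h' | h'
        · exact Or.inl (h'.symm.trans h)
        · right
          rw [h'] at h
          obtain ⟨rfl, h2⟩ := Sigma.mk.inj_iff.mp h
          have h3 : X.kbar i' k' = k := eq_of_heq h2
          rw [← h3, X.kbar_kbar]
      · rintro (h | h)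
        · obtain ⟨rfl, h2⟩ := Sigma.mk.inj_iff.mp h
          obtain rfl := eq_of_heq h2
          exact ⟨hκ, hrepk⟩
        · obtain ⟨rfl, h2⟩ := Sigma.mk.inj_iff.mp h
          obtain rfl := eq_of_heq h2
          exact ⟨(hpair i' k).trans hκ, (hrep_kbar i' k).trans hrepk⟩
    rw [hset, Finset.card_union_of_disjoint, LinkData.card_filter_block, LinkData.card_filter_block]
    · exact ⟨D, rfl⟩
    · rw [Finset.disjoint_filter]
      intro c' _ h h'
      rw [h] at h'
      obtain ⟨-, h2⟩ := Sigma.mk.inj_iff.mp h'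
      exact X.kbar_ne i k (eq_of_heq h2).symm
  · -- nothing
    have hset : ((univ.filter fun c' : LCol m D n =>
        X.ucol φ c'.1 c'.2.1 = X.ucol φ c.1 c.2.1).filter
        fun c' => rep ⟨c'.1, c'.2.1⟩ = ⟨i, k⟩) = ∅ := by
      rw [Finset.filter_eq_empty_iff]
      intro c' hc' h
      rw [Finset.mem_filter] at hc'
      apply hκ
      obtain ⟨i', k', t'⟩ := c'
      dsimp only at h hc'
      have hrr : rep (rep ⟨i', k'⟩) = rep ⟨i', k'⟩ := by
        rcases hfib i' k' with h' | h'
        · rw [h']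
          exact h'
        · rw [h', hrep_kbar]
          exact h'
      rw [h] at hrr
      refine ⟨?_, hrr⟩
      rcases hfib i' k' with h' | h'
      · rw [h'] at h
        obtain ⟨rfl, h2⟩ := Sigma.mk.inj_iff.mp h
        obtain rfl := eq_of_heq h2
        exact hc'.2
      · rw [h'] at h
        obtain ⟨rfl, h2⟩ := Sigma.mk.inj_iff.mp h
        obtain rfl := eq_of_heq h2
        rw [hpair]
        exact hc'.2
    rw [hset, Finset.card_empty]
    exact Even.zero

end regular

end OddLinkData

end IK2020

end Literature.Computability.AlgebraicComplexity
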